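import Summits.ResolutionOfSingularities.ResolutionOfSingularities.Theorems.MarkedTransferCampaignW13RFlatCanonicalPosSurfaceAllPArc
import HarnessLib

/-!
# [OURS · L1 W1.3] The rung-1 content Prop on `𝒞_can` FAILS FOR SURFACES IN EVERY CHARACTERISTIC (part 2/2): for every
# prime `p` and every field `K` of characteristic `p`, `¬ CampaignW13RFlatCanonicalPos p K (2 : Fin 3)` — ONE family,
# containing g2's surface S at `p = 2` (seat res-L1-s13-pv-1, g3)

LADDER-RESOLUTION rung L (rescue), cell `res-hironaka`, RESCUE-SEED slot W1.3 (architecture bypass, reading R-flat), F7′ row 1.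
p503083 (`p = 2`, the surface S `u² + (x₁+x₂)³ + x₁⁵x₂`) and p508341 (every `p`, but in FOUR variables `K[x,y,z,u]`) left open
whether the R-flat rung-1 failure on the coordinate-bound canonical class occurs for SURFACES in odd characteristic (kit
j271405 found `p = 3` witnesses of degree 16 computationally). THESE TWO FILES: yes, uniformly in `p`, in the census chart type
`MvPolynomial (Fin 3) K` (`X 0 = x`, `X 1 = y`, `X 2 = u`, tail variable `2`); part 1 =
`MarkedTransferCampaignW13RFlatCanonicalPosSurfaceAllPArc.lean` (the arc and `u^p ∉ ℘_alg(((g_p),p),1)`), this part = the canonical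
datum and the headline. THE FAMILY (`p = k + 2`, `L := y − x`):

  `F := L^p + x^{2p+1}`,  `M := x³·L^{p−2}`,  `ε_p := M^p + L^{p−1}·F^{p−1}`,  `g_p := u^p + ε_p`.

* `ε_p` is free of `u` and `p`-POWER-FREE (no monomial `x^a y^b` with `p ∣ a`, `p ∣ b`): the `p`-power monomials of
  `L^{p−1}F^{p−1} = Σ_k C(p−1,k) x^{(2p+1)k}(y^p−x^p)^{p−1−k}·Σ_{i<p} x^{p−1−i}y^i` are exactly the `k = 1, i = 0` ones,
  `(p−1)·x^{3p}(y^p−x^p)^{p−2} = −M^p`, and cancel against `M^p`; certified by the EULER CERTIFICATE `ε_p = x·∂ₓA_p + y·∂_yB_p`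
  (`surfAllP_euler`; p512821 `W13.exists_not_dvd_of_eq_euler`). So the datum (`e = 1`, tail `u`, `r = 0`) IS CANONICAL
  (`surfAllP_isCanonicalChain`); `ord₀ ε_p = p² − 1 > p`; `#monomials = p²(p+1)/2 − (p−1)` (5, 16, 71, 190 for p = 2,3,5,7);
  at `p = 2`, `ε₂ = (x+y)³ + x⁵y` = S of p503083 (`surfAllP_zero_eq_S`).
* THE ARC `γ(s) = (s^p, s^p − s^{2p+1}, −(s^{3p}(−s^{2p+1})^{p−2}))` lies ON `g_p = 0` (on the cusp `L^p = −x^{2p+1}` the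
  term `L^{p−1}F^{p−1}` vanishes and `u = −M`); along it every Hasse derivative `D^{(α)}g_p`, `1 ≤ |α| ≤ p−1`, vanishes
  identically EXCEPT `D_x^{(p−1)}`, of `s`-order `(p−1)(2p²+2p+1) = (2p³−2p+1) + (p−2)`, while `u^p∘γ = ±s^{2p(p²−1)}`. With
  `θ := s^{2p(p²−1)+1}` this is certified for all `α` at once in the SCALED-TAYLOR form of p506602's arc criterion (p512821
  `W13.not_mem_pAlgPiece_one_of_scaled_taylor`): `C(θ^p) ∣ g_p(γ + θ·v)` in `K[s][v₀,v₁,v₂]` — a ring identity valid in every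
  commutative ring of characteristic `p` (`surfAllP_ring_dvd`: freshman's dream for `(u+θv₂)^p`, `M(γ+θv)^p`; binomial remainder
  for `(ξ+θv₀)^{2p+1}` with `2p+1 ≡ 1`; first-order expansions of the two `(p−1)`-st powers).
* Hence `u^p ∉ ℘_alg(((g_p), p), 1)` (`surfAllP_tail_pow_not_mem`; stalk form `surfAllP_mul_tail_pow_not_mem`), `¬ RFlatTailPow`,
  and **`¬ CampaignW13RFlatCanonicalPos p K (2 : Fin 3)` for every prime `p` and every field `K` of characteristic `p`**
  (`Campaign.not_CampaignW13RFlatCanonicalPos_fin3_allChar`, `…_fin3_zmod`).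

How it was found (evidence trail): kit j271405's `p = 3` witness #1 (22 monomials, degree 16, arc `(s³, s³+2s⁷)`) reads in the
coordinates `(x, L = y − x)` as `x⁹L³ + L²(L³+x⁷)² − x²L¹⁴`; dropping the null-space term `x²L¹⁴` and writing `x⁹L³ = (x³L)³`,
`L²(L³+x⁷)² = L^{p−1}F^{p−1}` gives the pattern, which p503083's S also fits (`x⁶ + L(L²+x⁵)`). Verified numerically for
`p = 2,3,5,7` before typing (session search/family.py). Reading (prover's words; AI bookkeeping weaker than expert review): the
R-flat rung-1 feed on `𝒞_can` fails uniformly in `p` already for surfaces — neither «large `p`» nor «dimension 2» is a refuge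
for the coordinate-bound class; the failure is detected by an arc tangent to the hypersurface to high order (for `p ≥ 3` the
surface `g_p = 0` has a line of double points `y = x, u = 0`, and its order-`p` locus near `0` is expected to be the origin
alone — neither fact is certified or used here). What survives is class-wise (𝒞_Diff p482051, affine parity p504584, unit weighted
degree p509150) and presentation-wise (p503641). Caveat of record: nothing here bears on L-G4 / (127) (`KangarooShadeIncrease`).

HONEST FRAMING. OURS statements about the OURS bypass objects (bound algebraic `℘`, row 003 U17_2; candidate U17_4 not used);
nothing here is a statement of H. Hironaka's manuscript [Hironaka2017] (2017-03-23, lit key `paper:url-3343fd9e678b`); no claim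
about resolution of singularities in positive characteristic. Exponent parameter `k` with `p = k + 2` throughout §§1–3 (no
natural-number subtraction in exponents); §4 states the headline for a prime `p`. All decls `[folklore]`, sorry-free.
-/

noncomputable section

set_option linter.dupNamespace false -- mandated namespace of this single-conjunct summit

namespace Summit.ResolutionOfSingularities.ResolutionOfSingularities.Theorems.Campaign

open MvPolynomial
open Literature.AlgebraicGeometry.Resolution
open Literature.AlgebraicGeometry.Hironaka2017
open Literature.AlgebraicGeometry.Hironaka2017.S09LLUED (LLChainData)

namespace W13

/-! ## §3 The datum is CANONICAL for every `p`: `ε_p` is `p`-power-free, by the Euler certificate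
## `ε_p = x·∂ₓA + y·∂_yB` -/

section Canonical

variable (K : Type) [Field K] (k : ℕ) [hp : Fact (k + 2).Prime] [CharP K (k + 2)]

/-- Characteristic-`p` geometric sum: `Σ_{i<p} y^i x^{p−1−i} = (y − x)^{p−1}` in `K[x,y,u]` (`Σ·(y−x) = y^p − x^p = (y−x)^p`,
cancel `y − x ≠ 0`). [folklore] -/
theorem surfAllP_geom_sum :
    ∑ i ∈ Finset.range (k + 2), (X 1 : MvPolynomial (Fin 3) K) ^ i * X 0 ^ (k + 2 - 1 - i) = (X 1 - X 0) ^ (k + 1) := by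
  have h := geom_sum₂_mul (X 1 : MvPolynomial (Fin 3) K) (X 0) (k + 2)
  rw [← sub_pow_char (X 1 : MvPolynomial (Fin 3) K) (X 0)] at h
  have hne : (X 1 - X 0 : MvPolynomial (Fin 3) K) ≠ 0 :=
    sub_ne_zero.mpr fun e => absurd (MvPolynomial.X_injective e) (by decide)
  apply mul_right_cancel₀ hne
  rw [h, pow_succ]

/-- `Σ_{i<p−1} x^{p−2−i} y^{i+1} = (y−x)^{p−1} − x^{p−1}` (the previous sum without its `i = 0` term). [folklore] -/
theorem surfAllP_geom_sum' :
    ∑ i ∈ Finset.range (k + 1), (X 0 : MvPolynomial (Fin 3) K) ^ (k - i) * X 1 ^ (i + 1) =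
      (X 1 - X 0) ^ (k + 1) - X 0 ^ (k + 1) := by
  rw [eq_sub_iff_add_eq, ← surfAllP_geom_sum K k,
    Finset.sum_range_succ' (fun i => (X 1 : MvPolynomial (Fin 3) K) ^ i * X 0 ^ (k + 2 - 1 - i))]
  congr 1
  · refine Finset.sum_congr rfl fun i _ => ?_
    rw [mul_comm, show k + 2 - 1 - (i + 1) = k - i by omega]
  · rw [pow_zero, one_mul, show k + 2 - 1 - 0 = k + 1 by omega]

/-- One term of `y·∂_y W`: `y·∂_y(c·x^a y^{i+1}) = (i+1)c·x^a y^{i+1}`. [folklore] -/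
theorem surfAllP_y_pderiv_term (a i : ℕ) (c : K) :
    (X 1 : MvPolynomial (Fin 3) K) * pderiv 1 (C c * (X 0 ^ a * X 1 ^ (i + 1))) =
      C (c * ((i + 1 : ℕ) : K)) * (X 0 ^ a * X 1 ^ (i + 1)) := by
  rw [pderiv_C_mul, pderiv_mul, pderiv_pow, pderiv_X_of_ne (show (0 : Fin 3) ≠ 1 by decide), mul_zero, zero_mul,
    zero_add, pderiv_pow, pderiv_X_self, mul_one, Nat.add_sub_cancel, map_mul, map_natCast]
  ring

omit hp in
/-- One term of `x·∂ₓ A`: `x·∂ₓ(d·x^n·c^m) = n d·x^n c^m` for `c = y^p − x^p` (`∂ₓ c = −p x^{p−1} = 0`), `n ≥ 1`. [folklore] -/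
theorem surfAllP_x_pderiv_term (n m : ℕ) (hn : 1 ≤ n) (d : K) :
    (X 0 : MvPolynomial (Fin 3) K) * pderiv 0 (C d * (X 0 ^ n * (X 1 ^ (k + 2) - X 0 ^ (k + 2)) ^ m)) =
      C (d * (n : K)) * (X 0 ^ n * (X 1 ^ (k + 2) - X 0 ^ (k + 2)) ^ m) := by
  have hc : ((k + 2 : ℕ) : MvPolynomial (Fin 3) K) = 0 := CharP.cast_eq_zero _ (k + 2)
  have hdc : pderiv 0 ((X 1 : MvPolynomial (Fin 3) K) ^ (k + 2) - X 0 ^ (k + 2)) = 0 := by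
    simp only [map_sub, pderiv_pow, hc, zero_mul, sub_self]
  have hx : (X 0 : MvPolynomial (Fin 3) K) * X 0 ^ (n - 1) = X 0 ^ n := by
    rw [← pow_succ', Nat.sub_add_cancel hn]
  rw [pderiv_C_mul, pderiv_mul, pderiv_pow (f := X 0), pderiv_X_self, mul_one, pderiv_pow, hdc, mul_zero, mul_zero,
    add_zero, map_mul, map_natCast, ← hx]
  ring

omit hp in
/-- The exponents `n_j = (2p+1)j + p − 1`, `0 ≤ j ≤ p−1`, `j ≠ 1`, are NOT divisible by `p` (`n_j ≡ j − 1`). [folklore] -/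
theorem surfAllP_not_dvd_exp {j : ℕ} (hj : j ∈ (Finset.range (k + 2)).erase 1) :
    ¬ (k + 2) ∣ (2 * k + 5) * j + k + 1 := by
  obtain ⟨hj1, hj2⟩ := Finset.mem_erase.mp hj
  have hj2 := Finset.mem_range.mp hj2
  intro h
  rcases Nat.lt_or_ge j 1 with h0 | h1
  · have : j = 0 := by omega
    subst this
    have := Nat.le_of_dvd (by omega) h
    omega
  · obtain ⟨j', rfl⟩ : ∃ j', j = j' + 2 := ⟨j - 2, by omega⟩
    have e : (2 * k + 5) * (j' + 2) + k + 1 = (k + 2) * (2 * j' + 5) + (j' + 1) := by ring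
    rw [e] at h
    have h' := (Nat.dvd_add_right (dvd_mul_right _ _)).mp h
    have := Nat.le_of_dvd (by omega) h'
    omega

/-- **The Euler certificate** `ε_p = x·∂ₓA_p + y·∂_yB_p` with
`A_p = Σ_{j≠1} C(p−1,j)/n_j · x^{n_j}(y^p−x^p)^{p−1−j}` (`n_j = (2p+1)j+p−1`) and
`B_p = F^{p−1}·Σ_{i=1}^{p−1} (1/i)·x^{p−1−i}y^i` (`F = (y−x)^p + x^{2p+1}`): `y∂_yB_p = F^{p−1}((y−x)^{p−1} − x^{p−1})`
(`∂_yF = 0`, char-`p` geometric sum), `x∂ₓA_p = x^{p−1}F^{p−1} + M^p` (binomial theorem for `F^{p−1}`; the missing `j = 1`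
term is `(p−1)x^{3p}(y^p−x^p)^{p−2} = −M^p`). [folklore] -/
theorem surfAllP_euler :
    (((X 0 ^ 3 * (X 1 - X 0) ^ k) ^ (k + 2) +
        (X 1 - X 0) ^ (k + 1) * ((X 1 - X 0) ^ (k + 2) + X 0 ^ (2 * k + 5)) ^ (k + 1)) : MvPolynomial (Fin 3) K) =
      X 0 * pderiv 0 (∑ j ∈ (Finset.range (k + 2)).erase 1,
          C ((((k + 1).choose j : ℕ) : K) / (((2 * k + 5) * j + k + 1 : ℕ) : K)) *
            (X 0 ^ ((2 * k + 5) * j + k + 1) * (X 1 ^ (k + 2) - X 0 ^ (k + 2)) ^ (k + 1 - j))) +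
        X 1 * pderiv 1 (((X 1 - X 0) ^ (k + 2) + X 0 ^ (2 * k + 5)) ^ (k + 1) *
          ∑ i ∈ Finset.range (k + 1), C (((i + 1 : ℕ) : K)⁻¹) * (X 0 ^ (k - i) * X 1 ^ (i + 1))) := by
  have hcK : ((k + 2 : ℕ) : K) = 0 := CharP.cast_eq_zero K (k + 2)
  have hc : ((k + 2 : ℕ) : MvPolynomial (Fin 3) K) = 0 := CharP.cast_eq_zero _ (k + 2)
  -- the `y`-part
  have hF1 : pderiv 1 (((X 1 : MvPolynomial (Fin 3) K) - X 0) ^ (k + 2) + X 0 ^ (2 * k + 5)) = 0 := by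
    rw [map_add, pderiv_pow, hc, zero_mul, zero_mul, zero_add, pderiv_pow,
      pderiv_X_of_ne (show (0 : Fin 3) ≠ 1 by decide), mul_zero]
  have hW : (X 1 : MvPolynomial (Fin 3) K) *
      pderiv 1 (∑ i ∈ Finset.range (k + 1), C (((i + 1 : ℕ) : K)⁻¹) * (X 0 ^ (k - i) * X 1 ^ (i + 1))) =
        (X 1 - X 0) ^ (k + 1) - X 0 ^ (k + 1) := by
    rw [map_sum, Finset.mul_sum, ← surfAllP_geom_sum' K k]
    refine Finset.sum_congr rfl fun i hi => ?_
    have hi' : ((i + 1 : ℕ) : K) ≠ 0 := by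
      rw [Ne, CharP.cast_eq_zero_iff K (k + 2)]
      exact Nat.not_dvd_of_pos_of_lt (Nat.succ_pos i) (by have := Finset.mem_range.mp hi; omega)
    rw [surfAllP_y_pderiv_term, inv_mul_cancel₀ hi', map_one, one_mul]
  have hB : (X 1 : MvPolynomial (Fin 3) K) * pderiv 1 (((X 1 - X 0) ^ (k + 2) + X 0 ^ (2 * k + 5)) ^ (k + 1) *
      ∑ i ∈ Finset.range (k + 1), C (((i + 1 : ℕ) : K)⁻¹) * (X 0 ^ (k - i) * X 1 ^ (i + 1))) =
        ((X 1 - X 0) ^ (k + 2) + X 0 ^ (2 * k + 5)) ^ (k + 1) * ((X 1 - X 0) ^ (k + 1) - X 0 ^ (k + 1)) := by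
    rw [pderiv_mul, pderiv_pow, hF1, mul_zero, zero_mul, zero_add, ← mul_assoc, mul_comm (X 1), mul_assoc, hW]
  -- the `x`-part
  have hA : (X 0 : MvPolynomial (Fin 3) K) * pderiv 0 (∑ j ∈ (Finset.range (k + 2)).erase 1,
      C ((((k + 1).choose j : ℕ) : K) / (((2 * k + 5) * j + k + 1 : ℕ) : K)) *
        (X 0 ^ ((2 * k + 5) * j + k + 1) * (X 1 ^ (k + 2) - X 0 ^ (k + 2)) ^ (k + 1 - j))) =
      ∑ j ∈ (Finset.range (k + 2)).erase 1, C (((k + 1).choose j : ℕ) : K) *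
        (X 0 ^ ((2 * k + 5) * j + k + 1) * (X 1 ^ (k + 2) - X 0 ^ (k + 2)) ^ (k + 1 - j)) := by
    rw [map_sum, Finset.mul_sum]
    refine Finset.sum_congr rfl fun j hj => ?_
    have hn : (((2 * k + 5) * j + k + 1 : ℕ) : K) ≠ 0 := by
      rw [Ne, CharP.cast_eq_zero_iff K (k + 2)]
      exact surfAllP_not_dvd_exp k hj
    rw [surfAllP_x_pderiv_term K k _ _ (by omega), div_mul_cancel₀ _ hn]
  have hsum : ∑ j ∈ Finset.range (k + 2), C (((k + 1).choose j : ℕ) : K) *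
      ((X 0 : MvPolynomial (Fin 3) K) ^ ((2 * k + 5) * j + k + 1) * (X 1 ^ (k + 2) - X 0 ^ (k + 2)) ^ (k + 1 - j)) =
        X 0 ^ (k + 1) * ((X 1 - X 0) ^ (k + 2) + X 0 ^ (2 * k + 5)) ^ (k + 1) := by
    rw [sub_pow_char (X 1 : MvPolynomial (Fin 3) K) (X 0), add_comm (X 1 ^ (k + 2) - X 0 ^ (k + 2)), add_pow,
      Finset.mul_sum]
    refine Finset.sum_congr rfl fun j _ => ?_
    rw [map_natCast, ← pow_mul]
    ring
  have h1 : (1 : ℕ) ∈ Finset.range (k + 2) := Finset.mem_range.mpr (by omega)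
  have hk1 : ((k + 1 : ℕ) : K) = -1 := by
    have e : ((k + 1 : ℕ) : K) = ((k + 2 : ℕ) : K) - 1 := by push_cast; ring
    rw [e, hcK, zero_sub]
  have hM : ((X 0 ^ 3 * (X 1 - X 0) ^ k) ^ (k + 2) : MvPolynomial (Fin 3) K) =
      X 0 ^ ((2 * k + 5) * 1 + k + 1) * (X 1 ^ (k + 2) - X 0 ^ (k + 2)) ^ (k + 1 - 1) := by
    rw [mul_pow, ← pow_mul (X 1 - X 0), mul_comm k (k + 2), pow_mul (X 1 - X 0),
      sub_pow_char (X 1 : MvPolynomial (Fin 3) K) (X 0), Nat.add_sub_cancel, ← pow_mul]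
    ring
  rw [hA, hB, Finset.sum_erase_eq_sub h1, hsum, Nat.choose_one_right, hk1, hM, map_neg, map_one]
  ring

/-- **The datum is CANONICAL for every `p`**: `ε_p` is free of `u` and every monomial of it has an exponent not divisible by
`p` (Euler certificate `surfAllP_euler` + `exists_not_dvd_of_eq_euler`, p512821). [folklore] -/
theorem surfAllP_isCanonicalChain (d : LLChainData (MvPolynomial (Fin 3) K))
    (hdg : d.g 0 = X 2 ^ (k + 2) + ((X 0 ^ 3 * (X 1 - X 0) ^ k) ^ (k + 2) +
      (X 1 - X 0) ^ (k + 1) * ((X 1 - X 0) ^ (k + 2) + X 0 ^ (2 * k + 5)) ^ (k + 1)))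
    (hde : d.e = 1) (hdt : d.tail = X 2) :
    IsCanonicalChain (k + 2) K (2 : Fin 3) d := by
  classical
  have hx : ∀ i : Fin 3, i ≠ 2 → (X i : MvPolynomial (Fin 3) K) ∈ supported K ({2}ᶜ : Set (Fin 3)) :=
    fun i hi => (X_mem_supported (R := K)).mpr hi
  have h0 := hx 0 (by decide)
  have h1 := hx 1 (by decide)
  refine ⟨(X 0 ^ 3 * (X 1 - X 0) ^ k) ^ (k + 2) +
      (X 1 - X 0) ^ (k + 1) * ((X 1 - X 0) ^ (k + 2) + X 0 ^ (2 * k + 5)) ^ (k + 1), 0, ?_, by simp, ?_,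
    by rw [hdt, add_zero], ?_⟩
  · exact not_mem_vars_of_mem_supported (add_mem (pow_mem (mul_mem (pow_mem h0 3) (pow_mem (sub_mem h1 h0) k)) _)
      (mul_mem (pow_mem (sub_mem h1 h0) _) (pow_mem (add_mem (pow_mem (sub_mem h1 h0) _) (pow_mem h0 _)) _)))
  · rw [hdg, hde, pow_one]
  · rw [hde, pow_one, zero_pow hp.out.ne_zero, sub_zero]
    exact exists_not_dvd_of_eq_euler (k + 2) (0 : Fin 3) 1 _ _ (surfAllP_euler K k)

/-- **`¬ RFlatTailPow p`** (v4 schema) for every chain datum on `g_p` with `e = 1` and the canonical tail `u`. [folklore] -/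
theorem surfAllP_not_rFlatTailPow (d : LLChainData (MvPolynomial (Fin 3) K))
    (hdg : d.g 0 = X 2 ^ (k + 2) + ((X 0 ^ 3 * (X 1 - X 0) ^ k) ^ (k + 2) +
      (X 1 - X 0) ^ (k + 1) * ((X 1 - X 0) ^ (k + 2) + X 0 ^ (2 * k + 5)) ^ (k + 1)))
    (hde : d.e = 1) (hdt : d.tail = X 2) :
    ¬ Campaign.RFlatTailPow (k + 2) K (Ideal.span {d.g 0}) ((k + 2) ^ d.e) d := by
  rw [Campaign.RFlatTailPow, hdg, hde, hdt, pow_one]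
  exact surfAllP_tail_pow_not_mem K k

omit hp [CharP K (k + 2)] in
/-- **At `p = 2` the family member is g2's surface S** (p503083): `(x³L⁰)² + L·(L² + x⁵) = (x₁+x₂)³ + x₁⁵x₂` in characteristic
`2`. [folklore] -/
theorem surfAllP_zero_eq_S [CharP K 2] :
    ((X 0 ^ 3 * (X 1 - X 0) ^ 0) ^ (0 + 2) +
        (X 1 - X 0) ^ (0 + 1) * ((X 1 - X 0) ^ (0 + 2) + X 0 ^ (2 * 0 + 5)) ^ (0 + 1) : MvPolynomial (Fin 3) K) =
      X 0 ^ 3 + X 0 ^ 2 * X 1 + X 0 * X 1 ^ 2 + X 1 ^ 3 + X 0 ^ 5 * X 1 := by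
  have h2 : (2 : MvPolynomial (Fin 3) K) = 0 := CharTwo.two_eq_zero
  linear_combination (-2 * X 0 * X 1 ^ 2 + X 0 ^ 2 * X 1 - X 0 ^ 3 : MvPolynomial (Fin 3) K) * h2

end Canonical

end W13

/-! ## §4 The content Prop fails FOR SURFACES in EVERY positive characteristic -/

section HeadlineSurfaceAllP

/-- **REFUTATION of `Campaign.CampaignW13RFlatCanonicalPos p K (2 : Fin 3)` for EVERY prime `p` and EVERY field `K` of
characteristic `p`** (the census chart `K[x₁,x₂,u]`, a SURFACE in `𝔸³`, tail variable `2`): the canonical datum on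
`g_p = u^p + (x³L^{p−2})^p + L^{p−1}(L^p + x^{2p+1})^{p−1}`, `L = x₂ − x₁`, violates `RFlatTailPow`. At `p = 2` this is S of
p503083; p508341 needed the fourth variable. [folklore] -/
theorem not_CampaignW13RFlatCanonicalPos_fin3_allChar (K : Type) [Field K] (p : ℕ) [hp : Fact p.Prime] [CharP K p] :
    ¬ CampaignW13RFlatCanonicalPos p K (2 : Fin 3) := by
  obtain ⟨k, rfl⟩ : ∃ k, p = k + 2 := ⟨p - 2, (Nat.sub_add_cancel hp.out.two_le).symm⟩
  intro h
  have key : ∀ d : LLChainData (MvPolynomial (Fin 3) K),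
      d.g 0 = X 2 ^ (k + 2) + ((X 0 ^ 3 * (X 1 - X 0) ^ k) ^ (k + 2) +
        (X 1 - X 0) ^ (k + 1) * ((X 1 - X 0) ^ (k + 2) + X 0 ^ (2 * k + 5)) ^ (k + 1)) → d.e = 1 → d.tail = X 2 → False :=
    fun d hdg hde hdt =>
      W13.surfAllP_not_rFlatTailPow K k d hdg hde hdt (h d (W13.surfAllP_isCanonicalChain K k d hdg hde hdt))
  exact key ⟨1, fun _ => X 2,
      fun j => if j = 0 then X 2 ^ (k + 2) + ((X 0 ^ 3 * (X 1 - X 0) ^ k) ^ (k + 2) +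
        (X 1 - X 0) ^ (k + 1) * ((X 1 - X 0) ^ (k + 2) + X 0 ^ (2 * k + 5)) ^ (k + 1)) else X 2,
      fun _ => (X 0 ^ 3 * (X 1 - X 0) ^ k) ^ (k + 2) +
        (X 1 - X 0) ^ (k + 1) * ((X 1 - X 0) ^ (k + 2) + X 0 ^ (2 * k + 5)) ^ (k + 1),
      fun _ => 0, fun _ => ((k + 2) ^ 2 - 1 : ℕ)⟩
    (by simp) rfl (by simp [LLChainData.tail])

/-- In particular over the prime field: `¬ CampaignW13RFlatCanonicalPos p 𝔽_p (2 : Fin 3)` for every prime `p`. [folklore] -/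
theorem not_CampaignW13RFlatCanonicalPos_fin3_zmod (p : ℕ) [Fact p.Prime] :
    ¬ CampaignW13RFlatCanonicalPos p (ZMod p) (2 : Fin 3) :=
  not_CampaignW13RFlatCanonicalPos_fin3_allChar (ZMod p) p

end HeadlineSurfaceAllP

end Summit.ResolutionOfSingularities.ResolutionOfSingularities.Theorems.Campaign

end
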